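import Literature.Computability.Cryptography.SamplerCoinLaws
import Literature.Computability.Complexity.CodeFPBudgets
import Literature.Computability.Complexity.StackUnaryBits
import Literature.Probability.Distributions.IndepProductLawDistance
import HarnessLib

/-!
# Matrices of samples read off a coin string: law and polynomial time; coin boxes are uniform

Topic `Computability/Cryptography` (family `pqc`), companion of `CoinBlockLaws.lean` and
`FirstSuccessBlocksCoins.lean`. One run of `W(B*, s)` in Micciancio–Regev's Thm. 5.23 (authors' version
p. 29, through Lemma 5.7 / Thm. 5.9 steps 2–3) samples `m` grid noises `Kᵢ ∈ ℤⁿ` coordinate by coordinate with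
a coin-driven sampler, and `m` coin boxes `κᵢ ∈ [0, 2^ℓ)ⁿ`; a machine reads both as an `m × n` table of values
of a word function `f` on consecutive chunks of width `C` of its coins (`readMat`). This file proves, generically
in `f`:

* `readMat_eq_ofFn`, **`map_readMat_eq`** — on a uniform string of length `≥ n C m` the table has law
  `(⨂ᵐ ⨂ⁿ (U {0,1}^C).map f)` (listed by `ofFn`): independent rows of independent entries
  (`uniformVector_map_chunks_eq_indepLaw` twice, `indepLaw_map_pi`);
* **`readMat_codeFP`** — the table is typed polynomial time in `(context, (1^C, 1^n, 1^m), coins)` when `f` is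
  typed polynomial time in `(context, word)`;
* `vectorEquivFin`, **`uniformVector_map_bitsToNat`** — the value of a uniform `ℓ`-bit word is uniform on
  `[0, 2^ℓ)`: `(U {0,1}^ℓ).map bitsToNat = (U (Fin 2^ℓ)).map val`, whence `indepLaw_bitsToNat_eq_box`: `n` box
  coordinates read off `n` chunks have the law `(U (Fin n → Fin 2^ℓ)).map (x ↦ (xᵢ : ℤ)ᵢ)` (the `boxLaw n ℓ` of
  `Algebra/EuclideanLattices/DualGridQueryUniformity.lean`).

All proved; one definition with body (`readMat`) and one `Equiv`.

## References

* D. Micciancio, O. Regev, *Worst-case to average-case reductions based on Gaussian measures*, SIAM J. Comput.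
  37 (2007) 267–302, Thm. 5.9 (steps 2–3, p. 22) and Thm. 5.23 (proof, step (2), p. 29).
* S. Arora, B. Barak, *Computational Complexity: A Modern Approach*, CUP 2009, Def. 7.1, §7.4.1 [AroraBarak2009].
-/

noncomputable section

namespace Literature.Computability.Cryptography

namespace CoinReaders

open Literature.Computability.Complexity Literature.Computability.Complexity.CodeFP
  Literature.Probability.Distributions PMF Finset
open scoped ENNReal

variable {α : Type}

/-- **The `m × n` table of values of `f` on consecutive chunks**: row `i` is the `i`-th chunk of width `n C`,
entry `(i, j)` the value of `f` on its `j`-th sub-chunk of width `C`. [cite: MicciancioRegev2007, Thm. 5.9 (steps 2–3)] -/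
def readMat (f : List Bool → α) (C n m : ℕ) (r : List Bool) : List (List α) :=
  (List.range m).map fun i => (List.range n).map fun j => f (chunk C (chunk (n * C) r i) j)

/-- `List.ofFn` over `Fin m` as a map over `range m`. [folklore] -/
theorem ofFn_eq_map_range'' {β : Type*} {m : ℕ} (g : ℕ → β) : (List.ofFn fun j : Fin m => g j) = (List.range m).map g := by
  apply List.ext_getElem (by simp)
  intro i h₁ h₂
  simp

/-- One row as a function of its sub-chunks. [folklore] -/
def rowOf (f : List Bool → α) (C n : ℕ) (w : List.Vector Bool (n * C)) : Fin n → α :=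
  fun j => f (chunks C n (le_of_eq (Nat.mul_comm C n)) w j).toList

/-- **The table as an `ofFn` over the nested chunks.** [folklore] -/
theorem readMat_eq_ofFn (f : List Bool → α) (C n m : ℕ) {Ct : ℕ} (h : n * C * m ≤ Ct) (r : List.Vector Bool Ct) :
    readMat f C n m r.toList = List.ofFn fun i : Fin m => List.ofFn (rowOf f C n (chunks (n * C) m h r i)) := by
  rw [readMat, ← ofFn_eq_map_range'']
  congr 1
  funext i
  rw [← ofFn_eq_map_range'' (fun j => f (chunk C (chunk (n * C) r.toList i) j))]
  rfl

/-- **The law of the table on uniform coins**: independent rows of independent entries of law `(U {0,1}^C).map f`.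
[cite: AroraBarak2009, Def. 7.1, §7.4.1] -/
theorem map_readMat_eq (f : List Bool → α) (C n m : ℕ) {Ct : ℕ} (h : n * C * m ≤ Ct) :
    (uniformOfFintype (List.Vector Bool Ct)).map (fun r => readMat f C n m r.toList) =
      (indepLaw m fun _ => indepLaw n fun _ => (uniformOfFintype (List.Vector Bool C)).map fun w => f w.toList).map
        fun K => List.ofFn fun i => List.ofFn (K i) := by
  classical
  have h1 : (fun r : List.Vector Bool Ct => readMat f C n m r.toList) =
      (fun K : Fin m → Fin n → α => List.ofFn fun i => List.ofFn (K i)) ∘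
        (fun b : Fin m → List.Vector Bool (n * C) => fun i => rowOf f C n (b i)) ∘ chunks (n * C) m h := by
    funext r; exact readMat_eq_ofFn f C n m h r
  rw [h1, ← PMF.map_comp, ← PMF.map_comp, uniformVector_map_chunks_eq_indepLaw, indepLaw_map_pi m _ (fun _ w => rowOf f C n w)]
  congr 1
  refine congrArg (indepLaw m) (funext fun _ => ?_)
  have h2 : (rowOf f C n : List.Vector Bool (n * C) → Fin n → α) =
      (fun ws : Fin n → List.Vector Bool C => fun j => f (ws j).toList) ∘ chunks C n (le_of_eq (Nat.mul_comm C n)) := by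
    funext w; rfl
  rw [h2, ← PMF.map_comp, uniformVector_map_chunks_eq_indepLaw]
  exact indepLaw_map_pi n _ (fun _ (w : List.Vector Bool C) => f w.toList)

/-! ### Polynomial time -/

variable {σ : Type} {eσ : σ → List Bool} {eα : α → List Bool}

/-- Product of unary numerals (through unit budgets). [cite: AroraBarak2009, §1.3] -/
theorem unMul' : CodeFP (pairE unE unE) unE (fun p => p.1 * p.2) :=
  ((ulength unitE).comp (unitsMul.comp ((replicateUnit.comp (fst _ _)).pair (replicateUnit.comp (snd _ _))))).congr
    fun p => by simp

/-- The code of the reader's arguments: `⟨context, ⟨⟨1^C, ⟨1^n, 1^m⟩⟩, coins⟩⟩`. [folklore] -/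
abbrev rdE (eσ : σ → List Bool) : σ × ((ℕ × (ℕ × ℕ)) × List Bool) → List Bool :=
  pairE eσ (pairE (pairE unE (pairE unE unE)) strE)

/-- **The table is typed polynomial time** when `f` is, uniformly in the unary parameters.
[cite: AroraBarak2009, §1.3 (composition, bounded loops)] -/
theorem readMat_codeFP {f : σ → List Bool → α} (hf : CodeFP (pairE eσ strE) eα (fun p => f p.1 p.2)) :
    CodeFP (rdE eσ) (rawE (rawE eα)) (fun p => readMat (f p.1) p.2.1.1 p.2.1.2.1 p.2.1.2.2 p.2.2) := by
  have hs : CodeFP (rdE eσ) eσ (fun p => p.1) := fst _ _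
  have hC : CodeFP (rdE eσ) unE (fun p => p.2.1.1) := (snd _ _).fst'.fst'
  have hn : CodeFP (rdE eσ) unE (fun p => p.2.1.2.1) := (snd _ _).fst'.snd'.fst'
  have hm : CodeFP (rdE eσ) unE (fun p => p.2.1.2.2) := (snd _ _).fst'.snd'.snd'
  have hr : CodeFP (rdE eσ) strE (fun p => p.2.2) := (snd _ _).snd'
  have hnC : CodeFP (rdE eσ) unE (fun p => p.2.1.2.1 * p.2.1.1) := (unMul'.comp (hn.pair hC) :)
  have hrows : CodeFP (rdE eσ) (rawE strE)
      (fun p => (List.range p.2.1.2.2).map fun i => (p.2.2.drop (i * (p.2.1.2.1 * p.2.1.1))).take (p.2.1.2.1 * p.2.1.1)) :=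
    (strChunks.comp (hm.pair (hnC.pair hr)) :)
  have hctx : CodeFP (rdE eσ) (pairE eσ (pairE unE unE)) (fun p => (p.1, (p.2.1.1, p.2.1.2.1))) := hs.pair (hC.pair hn)
  have hsub : CodeFP (pairE (pairE eσ (pairE unE unE)) strE) (rawE strE)
      (fun t => (List.range t.1.2.2).map fun j => (t.2.drop (j * t.1.2.1)).take t.1.2.1) :=
    (strChunks.comp ((fst _ _).snd'.snd'.pair ((fst _ _).snd'.fst'.pair (snd _ _))) :)
  have hfc : CodeFP (pairE (pairE eσ (pairE unE unE)) strE) eα (fun t => f t.1.1 t.2) := (hf.comp ((fst _ _).fst'.pair (snd _ _)) :)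
  have hone : CodeFP (pairE (pairE eσ (pairE unE unE)) strE) (rawE eα)
      (fun t => ((List.range t.1.2.2).map fun j => (t.2.drop (j * t.1.2.1)).take t.1.2.1).map fun w => f t.1.1 w) :=
    ((map (g := fun q : (σ × (ℕ × ℕ)) × List Bool => f q.1.1 q.2) hfc).comp ((fst _ _).pair hsub) :)
  have hall := ((map hone).comp (hctx.pair hrows) :)
  refine hall.congr fun p => ?_
  obtain ⟨s, ⟨C, n, m⟩, r⟩ := p
  simp only [readMat, List.map_map]
  refine List.map_congr_left fun i _ => ?_
  simp only [Function.comp_apply]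
  refine List.map_congr_left fun j _ => ?_
  simp only [Function.comp_apply, chunk]
  rw [show C * j = j * C from Nat.mul_comm _ _, show n * C * i = i * (n * C) from Nat.mul_comm _ _]

/-! ### Coin boxes are uniform -/

/-- **`ℓ`-bit words and `[0, 2^ℓ)` correspond by value** (`bitsToNat`, inverse `natBits`). [folklore] -/
def vectorEquivFin (ℓ : ℕ) : List.Vector Bool ℓ ≃ Fin (2 ^ ℓ) := by
  refine Equiv.ofBijective (fun w => ⟨bitsToNat w.toList, by simpa using bitsToNat_lt w.toList⟩) ?_
  rw [Fintype.bijective_iff_surjective_and_card]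
  refine ⟨fun i => ⟨⟨Complexity.natBits ℓ i, Complexity.length_natBits ℓ i⟩, ?_⟩, by simp [card_vector]⟩
  ext
  exact Complexity.bitsToNat_natBits i.isLt

/-- `vectorEquivFin` computes `bitsToNat`. [folklore] -/
@[simp] theorem vectorEquivFin_apply_val (ℓ : ℕ) (w : List.Vector Bool ℓ) : ((vectorEquivFin ℓ w : Fin (2 ^ ℓ)) : ℕ) = bitsToNat w.toList := rfl

/-- **The value of a uniform `ℓ`-bit word is uniform on `[0, 2^ℓ)`** (as an integer). [cite: AroraBarak2009, Def. 7.1] -/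
theorem uniformVector_map_bitsToNat (ℓ : ℕ) :
    (uniformOfFintype (List.Vector Bool ℓ)).map (fun w => (bitsToNat w.toList : ℤ)) =
      (uniformOfFintype (Fin (2 ^ ℓ))).map fun x : Fin (2 ^ ℓ) => ((x : ℕ) : ℤ) := by
  have h : (fun w : List.Vector Bool ℓ => (bitsToNat w.toList : ℤ)) = (fun x : Fin (2 ^ ℓ) => ((x : ℕ) : ℤ)) ∘ vectorEquivFin ℓ := by
    funext w; rfl
  rw [h, ← PMF.map_comp (vectorEquivFin ℓ) _ (fun x : Fin (2 ^ ℓ) => ((x : ℕ) : ℤ)), uniformOfFintype_map_equiv]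

/-- **`n` box coordinates read off `n` chunks are a uniform box** `(U (Fin n → Fin 2^ℓ)).map (x ↦ (xᵢ)ᵢ)`.
[cite: MicciancioRegev2007, Thm. 5.9 (step 2: "vᵢ uniform in a box")] -/
theorem indepLaw_bitsToNat_eq_box (n ℓ : ℕ) :
    (indepLaw n fun _ => (uniformOfFintype (List.Vector Bool ℓ)).map fun w => (bitsToNat w.toList : ℤ)) =
      (uniformOfFintype (Fin n → Fin (2 ^ ℓ))).map fun (x : Fin n → Fin (2 ^ ℓ)) i => ((x i : ℕ) : ℤ) := by
  rw [uniformVector_map_bitsToNat, ← indepLaw_map_pi n (fun _ => uniformOfFintype (Fin (2 ^ ℓ))) (fun _ x => ((x : ℕ) : ℤ)),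
    indepLaw_uniformOfFintype]

end CoinReaders

end Literature.Computability.Cryptography

end
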